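import Summits.HodgeConjecture.HodgeConjecture.Theses.PadicSemiregularLift
import Literature.AlgebraicGeometry.HodgeTheory.SemiregularityObstructionBridge
import Literature.AlgebraicGeometry.Motives.HodgeSheaves
import Summits.HodgeConjecture.HodgeConjecture.Theorems.PadicPridhamSemiregularity.Negative.DividedPowerWindowCollapse
import Summits.HodgeConjecture.HodgeConjecture.Theorems.PadicPridhamSemiregularity.Negative.TorsorTest

/-!
# Line `crystalline-abel-jacobi` — skeleton for crux `PadicPridhamSemiregularity` (stmt-HodgeConjecture-13815)

Route `HodgeConjecture/PadicSemiregularLift`, crux P1b (rank 2, INFORMAL in the route file: no Lean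
signature). Idea card `Cruxes/PadicPridhamSemiregularity/Ideas/crystalline-abel-jacobi.md`: Pridham's
generalised Abel–Jacobi map (arXiv:1208.3111 §1.1, §2.3) transplanted from a characteristic-`0` field
to the base `W = W(k)` — the ONE use of Goodwillie's theorem (nil-invariance of the "absolute"
cohomology, p. 3: "Goodwillie's Theorem implies that `HP^k(X_A)` is formally étale as a functor in
`A`") is discharged by the GIVEN smooth lift `𝒳/W`, the constant term being `RΓ_dR(𝒳^/W)` pulled
back to every `X_A = 𝒳 ⊗_W A` (TRIAGE-r1-2 (a): no Berthelot invariance), REPAIRED as the panel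
demanded: the COARSE functor `J(A) = fib(RΓ_dR(𝒳^/W) → RΓ(X_A, Ω^{<r}_{X_A/A}))[2r]` (TRIAGE-r1-1:
the PD-filtered `J^r_W` is not homogeneous), Pridham's Lemma 1.7 run only on the PD-square-zero
steps `W_{n+2} → W_{n+1}` of the Witt tower (TRIAGE-r1-3), where the divided-power window collapses
(`Negative.dividedPowerWindowCollapse`, imported and used in §8).

SECOND-GENERATION SKELETON (planner crux-plan g2, 2026-08-16). It keeps the audited conclusion, the
level cut and all proved glue of the first generation and CHANGES THE STUBS in one respect that
matters: the normalised crystalline Abel–Jacobi datum is now ONE `K₀`-ADDITIVE CHARACTER PER LEVEL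
(`δ_r` on `im(K₀(X_{n+1}) → K₀(X_k))`, the same for every bundle), not one datum per bundle `E₁`.
Reason (junk audit of the first generation, line card §2): with `δ` chosen per `E₁` the datum is
satisfiable by junk for every NON-semiregular `E₁` (`δ := 0`, `ob ∈ ker σ`), so its advertised
content "the identity for all `E₁`" was only the torsor-test uniformity for semiregular `E₁`; with
one character per level, `K₀`-additivity ACROSS bundles (Disproof F1's additivity of `σ ∘ ob`,
now a consequence), the image constraint `δ[E] ∈ ±σ_E(Ext²(E,E))` for every bundle and the
detection of every non-extendable lift with semiregular special fibre all become typed content,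
while the composition and its hypotheses are unchanged.

## What this file proves and what it leaves as stubs

* `PadicPridhamSemiregularity` — the TYPED READING, on REAL carriers, of the informal crux, CLAIM
  (ii′) "p-adically semiregular `E₁` satisfies (⋆) CLASS-LIFTS-IMPLY-OBJECT-LIFTS at every level",
  (⋆) VERBATIM the hypothesis clause of the typed sibling crux
  `…Theses.PadicSemiregularLift.FormalLiftingFromClassLifting`, p-adic semiregularity instantiated
  by its real `{0,1}`-part `HodgeTheory.IsZeroOneSemiregular` (`σ₀ = Tr`, `σ₁ = Tr(At ∘ −)` on
  Mathlib's `Ext`; `σ_q`, `q ≥ 2`, has no carrier yet — for relative dimension `d ≤ 3` the two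
  notions coincide), torsion-free Hodge cohomology in ALL bidegrees (`Motives.hodgeCohomology`).
  IDENTICAL to the first generation's reading (same name, same body), so the audit target
  `--crux-decl …CrystallineAbelJacobi.PadicPridhamSemiregularity` is stable.
* `IsStepCharacter 𝒳 n δ₀ δ₁ ε₀ ε₁` / `HasStepCharacter 𝒳 n` — the line's OUTPUT at the step
  `X_{n+1} ⊂ X_{n+2}`: the NORMALISED CRYSTALLINE ABEL–JACOBI CHARACTER of level `n`, additive maps
  `δ₀ : im(K₀(X_{n+1}) → K₀(X_k)) → H²(X_k, 𝒪)`, `δ₁ : (same) → H³(X_k, Ω¹)` [intended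
  `δ_{r-1} = (p^{n+1}_* ∘ ι)^{-1} ∘ π_{n+2} ∘ ch_r^cris`, `r = 1, 2`] killing the classes restricted
  from `K₀(X_{n+2})`, such that for EVERY finite locally free `F` on `X_{n+1}` with special fibre
  `E₁` some `o ∈ Ext²(E₁, E₁ ⊗ 𝒪)` [Illusie's obstruction of `F`] vanishes iff `F` extends to
  `X_{n+2}` and has `δ_{r-1}[E₁] = ε_{r-1} • σ_{r-1}(o)` (Pridham Cor. 2.20/2.23 shape over `W`:
  obstruction of `Ξ_r(F)` = tangent map `ι ∘ σ_{r-1}` applied to `ob F`, Lemma 1.7; = Hodge defect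
  of `ch_r^cris` by the fibre sequence of the coarse `J`; last column by the window collapse).
* STUBS (registered, the only `sorry`s): `stub_firstStepCharacter` (`n = 0`: `X₁ ⊂ X₂`, the
  Bloch–Esnault–Kerz refined class, transversality automatic) and `stub_deepStepsCharacter`
  (`n ≥ 1`: window collapse + Cartan / `L_{X_{n+1}/W}` calculus). HARDEST: `stub_deepStepsCharacter`.
* `PadicPridhamSemiregularity_of` — the two stubs imply the crux reading (kernel-checked, no
  `sorry`): Disproof §7 `liftsStep_of_padicBlochIdentity` with `σ` the real `(σ₀, σ₁)` and the two
  injectivities (`p^{n+1}_*`: `H_tf`; `ι`: Deligne–Illusie, `d < p`) folded into the normalisation.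
* PROVED consequences that make the typed content visible and attackable: `uniform_extension`
  (torsor test: for `{0,1}`-semiregular `E₁`, if one lift to `X_{n+1}` extends to `X_{n+2}` then
  every lift does), `extends_of_vanishing` (P1a bypass: `δ[E₁] = 0` — the BEK Hodge condition read
  integrally under `H_tf` — makes EVERY lift extend, no `K₀` hypothesis), `liftsFormally_of_stepLifting`
  (tower assembly, `K₀`-free) and `liftsFormally_of_hodgeCharacters` (their composite: repaired P1
  at object level with `p > d`, `p` odd — `FormalLiftingFromClassLifting` becomes unnecessary).
* §8 imports and exercises the two landed Negative files of this crux
  (`…Theorems.PadicPridhamSemiregularity.Negative.DividedPowerWindowCollapse`, `…Negative.TorsorTest`).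

Disproof.lean used (refuter-cdisprove, cycles 1–2): F1 (`(ii′)` is additivity) — the character's
`K₀`-additivity across bundles CONTAINS F1's lever and this line additionally yields uniform step
lifting; F2 (`leak_model`, Milnor receptacle leaks) — receptacle here is the coarse de Rham one,
normalised into `H^{r+1}(X_k, Ω^{r-1})`; F3 (`not_lifts_without_classHypothesis`,
`star_false_without_injectivity`) — class hypothesis and semiregularity both kept in the reading; §7
(`not_liftsStep_without_pnInjective` = `H_tf` is a hypothesis of both stubs, entering at
`(p^{n+1}_*)^{-1}`; `not_liftsStep_without_iotaInjective` = `d < p` in both stubs, entering at `ι^{-1}`;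
`dividedPowerWindowCollapse` = `p ≠ 2`, `1 ≤ n` in `stub_deepStepsCharacter`, §8); §8
(`not_star_rational`) — integral `KZero` throughout; §6 torsor test (`semiregularityMap_sq_eq_zero`,
landed) — its content is the proved `uniform_extension`.
-/

noncomputable section

open CategoryTheory CategoryTheory.Limits AlgebraicGeometry

set_option linter.dupNamespace false

namespace Summit.HodgeConjecture.HodgeConjecture.Cruxes.PadicPridhamSemiregularity.CrystallineAbelJacobi

open Literature.AlgebraicGeometry.Motives Literature.AlgebraicGeometry.Motives.WittScheme
open Literature.AlgebraicGeometry.KTheory Literature.AlgebraicGeometry.HodgeTheory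
open Literature.AlgebraicGeometry.Deformation Literature.AlgebraicGeometry.Crystalline
open Literature.AlgebraicGeometry.Modules

/-! ## §0 Vocabulary on real carriers -/

/-- TORSION-FREE HODGE COHOMOLOGY of `𝒳/W` in ALL bidegrees: `Hᵇ(𝒳, Ωᵃ_{𝒳/W})` has no `p`-torsion
(Bloch–Esnault–Kerz Rem. 35 (2); the hypothesis the repaired P1 carries; automatic for abelian schemes
and smooth complete intersections). -/
def HodgeTorsionFree (p : ℕ) {O : Type} [CommRing O] (𝒳 : SchemeOver O) : Prop :=
  ∀ (a b : ℕ) (x : hodgeCohomology 𝒳 a b), (p : ℤ) • x = 0 → x = 0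

section Witt

variable {p : ℕ} [Fact p.Prime] {k : Type} [Field k] [CharP k p]

/-- `F` (on `X_{n+1}`) EXTENDS to a finite locally free sheaf on `X_{n+2}`. -/
def ExtendsToNextLevel (𝒳 : SchemeOver (WittVector p k)) (n : ℕ)
    (F : (thickening 𝒳 (n + 1)).left.Modules) : Prop :=
  ∃ F' : (thickening 𝒳 (n + 2)).left.Modules, IsFiniteLocallyFree F' ∧
    Nonempty ((Scheme.Modules.pullback (thickeningMap 𝒳 (Nat.le_succ (n + 1)))).obj F' ≅ F)

/-- (⋆) CLASS-LIFTS-IMPLY-OBJECT-LIFTS for `E₁` at every level of the `p`-adic tower of `𝒳` —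
verbatim the hypothesis clause of `FormalLiftingFromClassLifting` (stmt-HodgeConjecture-13825). -/
def ClassLiftsImplyObjectLifts (𝒳 : SchemeOver (WittVector p k))
    (E₁ : (specialFibre 𝒳).left.Modules) : Prop :=
  ∀ (n : ℕ) (F : (thickening 𝒳 (n + 1)).left.Modules) (hF : IsFiniteLocallyFree F),
    Nonempty ((Scheme.Modules.pullback (specialFibreToThickening 𝒳 n)).obj F ≅ E₁) →
    (∃ y : KZero (thickening 𝒳 (n + 2)).left,
      KZero.map (thickeningMap 𝒳 (Nat.le_succ (n + 1))) y = KZero.of F hF) →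
    ∃ F' : (thickening 𝒳 (n + 2)).left.Modules, IsFiniteLocallyFree F' ∧
      Nonempty ((Scheme.Modules.pullback (thickeningMap 𝒳 (Nat.le_succ (n + 1)))).obj F' ≅ F)

end Witt

/-! ## §1 The typed reading of the informal crux (audited conclusion of this line; unchanged) -/

/-- **TYPED READING of the informal crux `PadicPridhamSemiregularity` (P1b, CLAIM (ii′))** on real
carriers: for `k` perfect of characteristic `p`, `𝒳/W(k)` a smooth proper model of relative dimension
`d`, projective over `W`, with `d + 6 < p` and torsion-free Hodge cohomology in all bidegrees, every
finite locally free `E₁` on the special fibre which is `{0,1}`-SEMIREGULAR (`(σ₀, σ₁) = (Tr, Tr(At∘−))`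
injective on `Ext²(E₁,E₁)`, real: `HodgeTheory.IsZeroOneSemiregular`) satisfies (⋆): a finite locally
free lift `F` of `E₁` to `X_{n+1}` whose `K₀`-class is restricted from `K₀(X_{n+2})` is restricted
from a finite locally free sheaf on `X_{n+2}`. The (⋆)-clause is verbatim that of
`FormalLiftingFromClassLifting`; `{0,1}`-semiregular ⇒ p-adically semiregular, with equality for
`d ≤ 3`, so this is the informal crux for `d ≤ 3` and its `σ_{≤1}`-part beyond (the `σ_q`, `q ≥ 2`,
have no carrier in the tree yet). -/
def PadicPridhamSemiregularity : Prop :=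
  ∀ (p : ℕ) [Fact p.Prime] (k : Type) [Field k] [CharP k p] [PerfectRing k p] (d : ℕ)
    (𝒳 : Literature.AlgebraicGeometry.Motives.SchemeOver (WittVector p k)),
    Literature.AlgebraicGeometry.Motives.WittScheme.IsSmoothProperModel d 𝒳 →
    Literature.AlgebraicGeometry.Crystalline.IsProjectiveOverRing 𝒳 → d + 6 < p →
    (∀ (a b : ℕ) (x : Literature.AlgebraicGeometry.Motives.hodgeCohomology 𝒳 a b),
      (p : ℤ) • x = 0 → x = 0) →
    ∀ (E₁ : (Literature.AlgebraicGeometry.Motives.WittScheme.specialFibre 𝒳).left.Modules)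
      (hE₁ : Literature.AlgebraicGeometry.Motives.IsFiniteLocallyFree E₁),
      Literature.AlgebraicGeometry.HodgeTheory.IsZeroOneSemiregular hE₁ →
      ∀ (n : ℕ) (F : (Literature.AlgebraicGeometry.Motives.WittScheme.thickening 𝒳 (n + 1)).left.Modules)
        (hF : Literature.AlgebraicGeometry.Motives.IsFiniteLocallyFree F),
        Nonempty ((AlgebraicGeometry.Scheme.Modules.pullback
          (Literature.AlgebraicGeometry.Motives.WittScheme.specialFibreToThickening 𝒳 n)).obj F ≅ E₁) →
        (∃ y : Literature.AlgebraicGeometry.KTheory.KZero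
            (Literature.AlgebraicGeometry.Motives.WittScheme.thickening 𝒳 (n + 2)).left,
          Literature.AlgebraicGeometry.KTheory.KZero.map
            (Literature.AlgebraicGeometry.Motives.WittScheme.thickeningMap 𝒳 (Nat.le_succ (n + 1))) y =
            Literature.AlgebraicGeometry.KTheory.KZero.of F hF) →
        ∃ F' : (Literature.AlgebraicGeometry.Motives.WittScheme.thickening 𝒳 (n + 2)).left.Modules,
          Literature.AlgebraicGeometry.Motives.IsFiniteLocallyFree F' ∧
          Nonempty ((AlgebraicGeometry.Scheme.Modules.pullback
            (Literature.AlgebraicGeometry.Motives.WittScheme.thickeningMap 𝒳 (Nat.le_succ (n + 1)))).obj F' ≅ F)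

section Witt

variable {p : ℕ} [Fact p.Prime] {k : Type} [Field k] [CharP k p]

/-- The reading, unfolded: setting ⇒ `{0,1}`-semiregular ⇒ (⋆). -/
theorem padicPridhamSemiregularity_iff :
    PadicPridhamSemiregularity ↔
      ∀ (p : ℕ) [Fact p.Prime] (k : Type) [Field k] [CharP k p] [PerfectRing k p] (d : ℕ)
        (𝒳 : SchemeOver (WittVector p k)),
        IsSmoothProperModel d 𝒳 → IsProjectiveOverRing 𝒳 → d + 6 < p → HodgeTorsionFree p 𝒳 →
        ∀ (E₁ : (specialFibre 𝒳).left.Modules) (hE₁ : IsFiniteLocallyFree E₁),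
          IsZeroOneSemiregular hE₁ → ClassLiftsImplyObjectLifts 𝒳 E₁ :=
  Iff.rfl

/-! ## §2 The line's output at one step: the normalised crystalline Abel–Jacobi CHARACTER -/

/-- **`(δ₀, δ₁, ε₀, ε₁)` IS A NORMALISED CRYSTALLINE ABEL–JACOBI CHARACTER OF LEVEL `n`** for the
step `X_{n+1} ⊂ X_{n+2}` of the `p`-adic tower of `𝒳` (INTENDED values in brackets):
* `δ₀ : im(K₀(X_{n+1}) → K₀(X_k)) →+ H²(X_k, 𝒪)` and `δ₁ : (same) →+ H³(X_k, Ω¹_{X_k/k})` are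
  additive [`δ_{r-1} = (p^{n+1}_* ∘ ι)^{-1} ∘ π_{n+2} ∘ ch_r^cris`, `r = 1, 2`: the Hodge DEFECT
  `π_{n+2} : H^{2r}_dR(X_{n+2}/W_{n+2}) → H^{2r}(X_{n+2}, Ω^{<r})` of the crystalline Chern
  character, which on classes restricted from `X_{n+1}` lies in `ker(res) = im(p^{n+1}_*)`
  (Bockstein, `H_tf`) and in fact in the LAST COLUMN `im(p^{n+1}_* ∘ ι)`,
  `ι : H^{r+1}(X_k, Ω^{r-1}) → H^{2r}(X_k, Ω^{<r})` (TRANSVERSALITY = window collapse), read back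
  through the injective `p^{n+1}_* ∘ ι` (`H_tf` + Deligne–Illusie, `d < p`) — ONE map for all
  bundles, additive because `ch` is];
* (V) `δ` kills every class restricted from `K₀(X_{n+2})` [Chern classes of bundles on `X_{n+2}`
  are Hodge at level `n + 2`];
* (I) THE IDENTITY: for every finite locally free `F` on `X_{n+1}` and every finite locally free `E₁`
  on `X_k` with `F|X_k ≅ E₁` there is `o ∈ Ext²(E₁, E₁ ⊗ 𝒪_{X_k})` [Illusie's obstruction to
  extending `F` across the square-zero `X_{n+1} ⊂ X_{n+2}`, ideal `p^{n+1}𝒪/p^{n+2}𝒪 ≅ 𝒪_{X_k}`, read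
  on `X_k` by Lieblich's base change and transported along `F|X_k ≅ E₁`] such that `o = 0` iff `F`
  extends to a finite locally free sheaf on `X_{n+2}` [Illusie IV.3 / Stacks 08VR (1)], and
  `δ₀[E₁] = ε₀ • σ₀(o)`, `δ₁[E₁] = ε₁ • σ₁(o)` with universal signs `ε_r` and the REAL `σ₀ = Tr`,
  `σ₁ = Tr(At ∘ −)` (`sigmaZeroObstruction`, `sigmaOneObstruction`) [Pridham Cor. 2.20/2.23 shape
  over `W`: the obstruction to lifting `Ξ_r(F)` along `J(W_{n+2}) → J(W_{n+1})` is the tangent map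
  `ι ∘ σ_{r-1}` applied to `ob F` (Lemma 1.7), and equals the Hodge defect by the fibre sequence of
  the coarse `J`].
TYPED CONTENT (what survives every junk choice of the existential `o`, see the line card): `δ` is
ONE additive map per level, so (a) `δ[E] ∈ ±σ_E(Ext²(E, E ⊗ 𝒪))` for every bundle `E` in the range
(an image constraint even for non-semiregular `E`, e.g. `δ₁[E] = 0` whenever `At(E) = 0`);
(b) for `{0,1}`-semiregular `E₁` the element `o` is determined by `δ[E₁]`, hence independent of
the lift `F`: extendability across `X_{n+1} ⊂ X_{n+2}` is UNIFORM over all lifts of `E₁`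
(`uniform_extension`, the torsor test of Disproof §6 — false without `H_tf`); (c) `δ[E₁] ≠ 0` for
every semiregular `E₁` having a non-extendable lift, although `δ` kills `im K₀(X_{n+2})` and
`p · im K₀(X_{n+1})` (so "class lifts mod `p`" already forces extension); (d) additivity across
bundles: `σ(o_{F ⊕ F'}) = ±(σ(o_F) + σ(o_{F'}))` up to the units — Disproof F1's lever (A) as a
consequence. None of (a)–(d) holds for a per-bundle datum chosen by junk. -/
def IsStepCharacter (𝒳 : SchemeOver (WittVector p k)) (n : ℕ)
    (δ₀ : (KZero.map (specialFibreToThickening 𝒳 n)).range →+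
      structureSheafCohomology (specialFibre 𝒳).left 2)
    (δ₁ : (KZero.map (specialFibreToThickening 𝒳 n)).range →+ hodgeCohomologyOne (specialFibre 𝒳) 3)
    (ε₀ ε₁ : ℤˣ) : Prop :=
  (∀ x : (KZero.map (specialFibreToThickening 𝒳 n)).range,
    (∃ y : KZero (thickening 𝒳 (n + 2)).left,
      KZero.map (specialFibreToThickening 𝒳 (n + 1)) y = x.1) → δ₀ x = 0 ∧ δ₁ x = 0) ∧
  (∀ (E₁ : (specialFibre 𝒳).left.Modules) (hE₁ : IsFiniteLocallyFree E₁)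
      (F : (thickening 𝒳 (n + 1)).left.Modules) (_hF : IsFiniteLocallyFree F),
      Nonempty ((Scheme.Modules.pullback (specialFibreToThickening 𝒳 n)).obj F ≅ E₁) →
      ∀ hx : KZero.of E₁ hE₁ ∈ (KZero.map (specialFibreToThickening 𝒳 n)).range,
      ∃ o : obstructionGroup 2 E₁ (unitModule (specialFibre 𝒳).left),
        (o = 0 ↔ ∃ F' : (thickening 𝒳 (n + 2)).left.Modules, IsFiniteLocallyFree F' ∧
          Nonempty ((Scheme.Modules.pullback (thickeningMap 𝒳 (Nat.le_succ (n + 1)))).obj F' ≅ F)) ∧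
        δ₀ ⟨KZero.of E₁ hE₁, hx⟩ = ε₀ • sigmaZeroObstruction hE₁ o ∧
        δ₁ ⟨KZero.of E₁ hE₁, hx⟩ = ε₁ • sigmaOneObstruction hE₁ o)

/-- **The normalised crystalline Abel–Jacobi character of level `n` EXISTS.** -/
def HasStepCharacter (𝒳 : SchemeOver (WittVector p k)) (n : ℕ) : Prop :=
  ∃ (δ₀ : (KZero.map (specialFibreToThickening 𝒳 n)).range →+
      structureSheafCohomology (specialFibre 𝒳).left 2)
    (δ₁ : (KZero.map (specialFibreToThickening 𝒳 n)).range →+ hodgeCohomologyOne (specialFibre 𝒳) 3)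
    (ε₀ ε₁ : ℤˣ), IsStepCharacter 𝒳 n δ₀ δ₁ ε₀ ε₁

end Witt

/-! ## §3 The registered stubs (fully qualified restatements over tree declarations; the only `sorry`s) -/

/-- **STUB 1 — the character of the FIRST STEP `X₁ ⊂ X₂` (`n = 0`).** For `𝒳/W(k)` a smooth proper
model of relative dimension `d < p`, projective over `W`, `p` odd, with torsion-free Hodge cohomology
in all bidegrees, the normalised crystalline Abel–Jacobi character of level `0` exists: ONE pair of
additive maps `(δ₀, δ₁)` on `im(K₀(X₁) → K₀(X_k))` (all of `K₀(X_k)`: `X₁ ≅ X_k`) with values in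
`H²(X_k, 𝒪) × H³(X_k, Ω¹)` [`= ((p_* ι)^{-1} π₂ c₁^cris, (p_* ι)^{-1} π₂ ch₂^cris)`], killing the classes
restricted from `K₀(X₂)`, with `δ_{r-1}[E₁] = ε_{r-1} • σ_{r-1}(o)` for an `o ∈ Ext²(E₁, E₁ ⊗ 𝒪)`
vanishing iff the given lift `F` extends to `X₂`, for every pair (`F` on `X₁`, `F|X_k ≅ E₁`).
WHY PLAUSIBLE: at the first step `π₂(ch_r^cris)` is Bloch–Esnault–Kerz's refined class in
`H^{2r}(X₂, p(r)Ω)` with `p(r)Ω^j_{X₂} = p^{r-j}Ω^j = 0` for `j ≤ r − 2` (arXiv:1203.2776 Def. 33) —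
transversality is free (equivalently: Tate-ness `φ(ch_r) = p^r ch_r` + Fontaine–Laffaille, `d < p − 1`,
TRIAGE-r1-2 X1); `r = 1` is Berthelot–Ogus 3.8 level-wise plus `Tr ∘ ob = ob ∘ det` (all ranks);
`r = 2` is the mod-`p²` infinitesimal Abel–Jacobi formula `δ(ch₂) = ±σ₁(ob)` (Buchweitz–Flenner
Prop. 4.2 + Illusie IV.3.1.8 with `L_{X₁/W} = Ω¹ ⊕ 𝒪ε[1]`), calibrated on line bundles (`c₁²/2`:
defect `= c̄₁ ∪ o(L) = σ₁(o(L))`) and on `L ⊕ L⁻¹` by all three triagers. SIZE: L. -/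
theorem stub_firstStepCharacter :
    ∀ (p : ℕ) [Fact p.Prime] (k : Type) [Field k] [CharP k p] [PerfectRing k p] (d : ℕ)
      (𝒳 : Literature.AlgebraicGeometry.Motives.SchemeOver (WittVector p k)),
      Literature.AlgebraicGeometry.Motives.WittScheme.IsSmoothProperModel d 𝒳 →
      Literature.AlgebraicGeometry.Crystalline.IsProjectiveOverRing 𝒳 → p ≠ 2 → d < p →
      (∀ (a b : ℕ) (x : Literature.AlgebraicGeometry.Motives.hodgeCohomology 𝒳 a b),
        (p : ℤ) • x = 0 → x = 0) →
      ∃ (δ₀ : (Literature.AlgebraicGeometry.KTheory.KZero.map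
              (Literature.AlgebraicGeometry.Motives.WittScheme.specialFibreToThickening 𝒳 0)).range →+
            Literature.AlgebraicGeometry.Motives.structureSheafCohomology
              (Literature.AlgebraicGeometry.Motives.WittScheme.specialFibre 𝒳).left 2)
        (δ₁ : (Literature.AlgebraicGeometry.KTheory.KZero.map
              (Literature.AlgebraicGeometry.Motives.WittScheme.specialFibreToThickening 𝒳 0)).range →+
            Literature.AlgebraicGeometry.Motives.hodgeCohomologyOne
              (Literature.AlgebraicGeometry.Motives.WittScheme.specialFibre 𝒳) 3)
        (ε₀ ε₁ : ℤˣ),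
        (∀ x : (Literature.AlgebraicGeometry.KTheory.KZero.map
              (Literature.AlgebraicGeometry.Motives.WittScheme.specialFibreToThickening 𝒳 0)).range,
          (∃ y : Literature.AlgebraicGeometry.KTheory.KZero
              (Literature.AlgebraicGeometry.Motives.WittScheme.thickening 𝒳 (0 + 2)).left,
            Literature.AlgebraicGeometry.KTheory.KZero.map
              (Literature.AlgebraicGeometry.Motives.WittScheme.specialFibreToThickening 𝒳 (0 + 1)) y = x.1) →
          δ₀ x = 0 ∧ δ₁ x = 0) ∧
        (∀ (E₁ : (Literature.AlgebraicGeometry.Motives.WittScheme.specialFibre 𝒳).left.Modules)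
            (hE₁ : Literature.AlgebraicGeometry.Motives.IsFiniteLocallyFree E₁)
            (F : (Literature.AlgebraicGeometry.Motives.WittScheme.thickening 𝒳 (0 + 1)).left.Modules)
            (_hF : Literature.AlgebraicGeometry.Motives.IsFiniteLocallyFree F),
            Nonempty ((AlgebraicGeometry.Scheme.Modules.pullback
              (Literature.AlgebraicGeometry.Motives.WittScheme.specialFibreToThickening 𝒳 0)).obj F ≅ E₁) →
            ∀ hx : Literature.AlgebraicGeometry.KTheory.KZero.of E₁ hE₁ ∈
                (Literature.AlgebraicGeometry.KTheory.KZero.map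
                  (Literature.AlgebraicGeometry.Motives.WittScheme.specialFibreToThickening 𝒳 0)).range,
            ∃ o : Literature.AlgebraicGeometry.Deformation.obstructionGroup 2 E₁
                (Literature.AlgebraicGeometry.Modules.unitModule
                  (Literature.AlgebraicGeometry.Motives.WittScheme.specialFibre 𝒳).left),
              (o = 0 ↔
                ∃ F' : (Literature.AlgebraicGeometry.Motives.WittScheme.thickening 𝒳 (0 + 2)).left.Modules,
                  Literature.AlgebraicGeometry.Motives.IsFiniteLocallyFree F' ∧
                  Nonempty ((AlgebraicGeometry.Scheme.Modules.pullback
                    (Literature.AlgebraicGeometry.Motives.WittScheme.thickeningMap 𝒳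
                      (Nat.le_succ (0 + 1)))).obj F' ≅ F)) ∧
              δ₀ ⟨Literature.AlgebraicGeometry.KTheory.KZero.of E₁ hE₁, hx⟩ =
                  ε₀ • Literature.AlgebraicGeometry.HodgeTheory.sigmaZeroObstruction hE₁ o ∧
              δ₁ ⟨Literature.AlgebraicGeometry.KTheory.KZero.of E₁ hE₁, hx⟩ =
                  ε₁ • Literature.AlgebraicGeometry.HodgeTheory.sigmaOneObstruction hE₁ o) := by
  sorry

/-- **STUB 2 — the character of the DEEP STEPS `X_{n+1} ⊂ X_{n+2}`, `n ≥ 1` (HARDEST).** Same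
setting; for every `n ≥ 1` the normalised crystalline Abel–Jacobi character of level `n` exists:
`δ_{r-1} = (p^{n+1}_* ι)^{-1} ∘ π_{n+2} ∘ ch_r^cris` on `im(K₀(X_{n+1}) → K₀(X_k))`, `r = 1, 2`, killing
`im K₀(X_{n+2})`, with `δ_{r-1}[E₁] = ε_{r-1} • σ_{r-1}(ob(F; X_{n+2}))` for EVERY finite locally free
`F` on `X_{n+1}` and `E₁ ≅ F|X_k`. WHY PLAUSIBLE: Pridham's functoriality of obstructions
(arXiv:1208.3111 Lemma 1.7) for the coarse functor `J(A) = fib(RΓ_dR(𝒳^/W) → RΓ(X_A, Ω^{<r}_{X_A/A}))[2r]`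
on the PD-square-zero extension `W_{n+2} → W_{n+1}` (kernel `p^{n+1}W/p^{n+2}W`, `γ_{≥2} ≡ 0 mod p^{n+2}`
for `p` odd: the window collapse `n + 1 + v_p(j!) ≤ nj` of `Negative.dividedPowerWindowCollapse`, §8),
with tangent map `ι ∘ σ_{r-1}` (Pridham Prop. 2.12/Rem. 2.13 = Buchweitz–Flenner Prop. 4.2 on
`L_{X_{n+1}/W} = Ω¹ ⊕ 𝒪ε[1]`, Illusie IV.3.1.8: `ob(F) = ε`-component of `At_{X_{n+1}/W}(F)` mod `p`);
equivalently the extrinsic Čech–Cartan computation of card `cartan-classifying-map` (audited step by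
step in Disproof §7: no p-adic failure found). Both sides are functions of `(X_{n+2} ⊃ X_{n+1}, F)`;
`H_tf` enters only through the normalisation `(p^{n+1}_*)^{-1}` (Bockstein) and `d < p` through `ι^{-1}`
(Deligne–Illusie); additivity of `δ` on the `K₀`-range is that of `ch^cris`. First content beyond
print: `r = 2`, `d ≥ 4`, `n ≥ 1` (the `H⁴(𝒪)`-digit of `ch₂^cris` on an abelian fourfold). SIZE: XL. -/
theorem stub_deepStepsCharacter :
    ∀ (p : ℕ) [Fact p.Prime] (k : Type) [Field k] [CharP k p] [PerfectRing k p] (d : ℕ)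
      (𝒳 : Literature.AlgebraicGeometry.Motives.SchemeOver (WittVector p k)),
      Literature.AlgebraicGeometry.Motives.WittScheme.IsSmoothProperModel d 𝒳 →
      Literature.AlgebraicGeometry.Crystalline.IsProjectiveOverRing 𝒳 → p ≠ 2 → d < p →
      (∀ (a b : ℕ) (x : Literature.AlgebraicGeometry.Motives.hodgeCohomology 𝒳 a b),
        (p : ℤ) • x = 0 → x = 0) →
      ∀ (n : ℕ), 1 ≤ n →
      ∃ (δ₀ : (Literature.AlgebraicGeometry.KTheory.KZero.map
              (Literature.AlgebraicGeometry.Motives.WittScheme.specialFibreToThickening 𝒳 n)).range →+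
            Literature.AlgebraicGeometry.Motives.structureSheafCohomology
              (Literature.AlgebraicGeometry.Motives.WittScheme.specialFibre 𝒳).left 2)
        (δ₁ : (Literature.AlgebraicGeometry.KTheory.KZero.map
              (Literature.AlgebraicGeometry.Motives.WittScheme.specialFibreToThickening 𝒳 n)).range →+
            Literature.AlgebraicGeometry.Motives.hodgeCohomologyOne
              (Literature.AlgebraicGeometry.Motives.WittScheme.specialFibre 𝒳) 3)
        (ε₀ ε₁ : ℤˣ),
        (∀ x : (Literature.AlgebraicGeometry.KTheory.KZero.map
              (Literature.AlgebraicGeometry.Motives.WittScheme.specialFibreToThickening 𝒳 n)).range,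
          (∃ y : Literature.AlgebraicGeometry.KTheory.KZero
              (Literature.AlgebraicGeometry.Motives.WittScheme.thickening 𝒳 (n + 2)).left,
            Literature.AlgebraicGeometry.KTheory.KZero.map
              (Literature.AlgebraicGeometry.Motives.WittScheme.specialFibreToThickening 𝒳 (n + 1)) y = x.1) →
          δ₀ x = 0 ∧ δ₁ x = 0) ∧
        (∀ (E₁ : (Literature.AlgebraicGeometry.Motives.WittScheme.specialFibre 𝒳).left.Modules)
            (hE₁ : Literature.AlgebraicGeometry.Motives.IsFiniteLocallyFree E₁)
            (F : (Literature.AlgebraicGeometry.Motives.WittScheme.thickening 𝒳 (n + 1)).left.Modules)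
            (_hF : Literature.AlgebraicGeometry.Motives.IsFiniteLocallyFree F),
            Nonempty ((AlgebraicGeometry.Scheme.Modules.pullback
              (Literature.AlgebraicGeometry.Motives.WittScheme.specialFibreToThickening 𝒳 n)).obj F ≅ E₁) →
            ∀ hx : Literature.AlgebraicGeometry.KTheory.KZero.of E₁ hE₁ ∈
                (Literature.AlgebraicGeometry.KTheory.KZero.map
                  (Literature.AlgebraicGeometry.Motives.WittScheme.specialFibreToThickening 𝒳 n)).range,
            ∃ o : Literature.AlgebraicGeometry.Deformation.obstructionGroup 2 E₁
                (Literature.AlgebraicGeometry.Modules.unitModule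
                  (Literature.AlgebraicGeometry.Motives.WittScheme.specialFibre 𝒳).left),
              (o = 0 ↔
                ∃ F' : (Literature.AlgebraicGeometry.Motives.WittScheme.thickening 𝒳 (n + 2)).left.Modules,
                  Literature.AlgebraicGeometry.Motives.IsFiniteLocallyFree F' ∧
                  Nonempty ((AlgebraicGeometry.Scheme.Modules.pullback
                    (Literature.AlgebraicGeometry.Motives.WittScheme.thickeningMap 𝒳
                      (Nat.le_succ (n + 1)))).obj F' ≅ F)) ∧
              δ₀ ⟨Literature.AlgebraicGeometry.KTheory.KZero.of E₁ hE₁, hx⟩ =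
                  ε₀ • Literature.AlgebraicGeometry.HodgeTheory.sigmaZeroObstruction hE₁ o ∧
              δ₁ ⟨Literature.AlgebraicGeometry.KTheory.KZero.of E₁ hE₁, hx⟩ =
                  ε₁ • Literature.AlgebraicGeometry.HodgeTheory.sigmaOneObstruction hE₁ o) := by
  sorry

/-! ## §4 Named forms of the stubs, consistency, and the name-keyed aliases -/

/-- The first-step statement, named (the registered `sorry` is `stub_firstStepCharacter`, whose statement is
this one unfolded over tree declarations). -/
def FirstStepCharacter : Prop :=
  ∀ (p : ℕ) [Fact p.Prime] (k : Type) [Field k] [CharP k p] [PerfectRing k p] (d : ℕ)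
    (𝒳 : SchemeOver (WittVector p k)),
    IsSmoothProperModel d 𝒳 → IsProjectiveOverRing 𝒳 → p ≠ 2 → d < p → HodgeTorsionFree p 𝒳 →
    HasStepCharacter 𝒳 0

/-- The deep-steps statement, named (the registered `sorry` is `stub_deepStepsCharacter`). -/
def DeepStepsCharacter : Prop :=
  ∀ (p : ℕ) [Fact p.Prime] (k : Type) [Field k] [CharP k p] [PerfectRing k p] (d : ℕ)
    (𝒳 : SchemeOver (WittVector p k)),
    IsSmoothProperModel d 𝒳 → IsProjectiveOverRing 𝒳 → p ≠ 2 → d < p → HodgeTorsionFree p 𝒳 →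
    ∀ (n : ℕ), 1 ≤ n → HasStepCharacter 𝒳 n

/-- Consistency: the registered stub IS the named first-step statement (definitional unfolding only). -/
theorem firstStepCharacter_holds : FirstStepCharacter := stub_firstStepCharacter

/-- Consistency: the registered stub IS the named deep-steps statement (definitional unfolding only). -/
theorem deepStepsCharacter_holds : DeepStepsCharacter := stub_deepStepsCharacter

/-! ### Name-keyed aliases (the skeleton audit admits a hypothesis of `_of` whose head constant's last name
component is a registered stub name; gate-reserved `@[stub]` tags are not available to seat-written files) -/
namespace Forms

/-- Alias of `FirstStepCharacter` keyed by the registered stub name. -/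
abbrev stub_firstStepCharacter : Prop := FirstStepCharacter

/-- Alias of `DeepStepsCharacter` keyed by the registered stub name. -/
abbrev stub_deepStepsCharacter : Prop := DeepStepsCharacter

end Forms

/-! ## §5 Proved glue: tower bookkeeping -/

section Witt

variable {p : ℕ} [Fact p.Prime] {k : Type} [Field k] [CharP k p]

omit [Fact p.Prime] in
/-- `(W_{n+2} → W_{n+1} → k) = (W_{n+2} → k)`: the residue maps of the truncated Witt vectors are
compatible with the transition maps. -/
theorem wittQuotToResidue_comp_factor [Fact p.Prime] (n : ℕ) :
    (wittQuotToResidue p k n).comp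
        (Ideal.Quotient.factor (Ideal.pow_le_pow_right (Nat.le_succ (n + 1)))) =
      wittQuotToResidue p k (n + 1) := by
  apply Ideal.Quotient.ringHom_ext
  ext x
  simp [wittQuotToResidue]

set_option backward.isDefEq.respectTransparency false in
/-- **`X_k ⟶ X_{n+1} ⟶ X_{n+2}` is `X_k ⟶ X_{n+2}`**: the inclusion of the special fibre is compatible
with the transition maps of the `p`-adic tower. -/
theorem specialFibreToThickening_comp_thickeningMap (𝒳 : SchemeOver (WittVector p k)) (n : ℕ) :
    specialFibreToThickening 𝒳 n ≫ thickeningMap 𝒳 (Nat.le_succ (n + 1)) =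
      specialFibreToThickening 𝒳 (n + 1) := by
  apply pullback.hom_ext
  · simp only [specialFibreToThickening, thickeningMap, Category.assoc, pullback.lift_fst,
      Category.comp_id]
  · simp only [specialFibreToThickening, thickeningMap, Category.assoc, pullback.lift_snd,
      pullback.lift_snd_assoc]
    rw [← Spec.map_comp, ← CommRingCat.ofHom_comp, wittQuotToResidue_comp_factor]

/-- `K₀`-bookkeeping: if the class of a lift `F` of `E₁` to `X_{n+1}` is restricted from `K₀(X_{n+2})`,
then the class of `E₁` is restricted from `K₀(X_{n+2})` along `X_k ⟶ X_{n+2}`. -/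
theorem kZero_of_specialFibre_lifts (𝒳 : SchemeOver (WittVector p k)) {n : ℕ}
    {E₁ : (specialFibre 𝒳).left.Modules} (hE₁ : IsFiniteLocallyFree E₁)
    {F : (thickening 𝒳 (n + 1)).left.Modules} (hF : IsFiniteLocallyFree F)
    (α : (Scheme.Modules.pullback (specialFibreToThickening 𝒳 n)).obj F ≅ E₁)
    (h : ∃ y : KZero (thickening 𝒳 (n + 2)).left,
      KZero.map (thickeningMap 𝒳 (Nat.le_succ (n + 1))) y = KZero.of F hF) :
    ∃ y : KZero (thickening 𝒳 (n + 2)).left,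
      KZero.map (specialFibreToThickening 𝒳 (n + 1)) y = KZero.of E₁ hE₁ := by
  obtain ⟨y, hy⟩ := h
  refine ⟨y, ?_⟩
  rw [← specialFibreToThickening_comp_thickeningMap 𝒳 n, KZero.map_comp_apply, hy, KZero.map_of]
  exact KZero.of_iso α _ _

/-- The class of `E₁` lies in the image of `K₀(X_{n+1}) → K₀(X_k)` as soon as `E₁` has a finite locally
free lift `F` to `X_{n+1}`. -/
theorem kZero_of_mem_range (𝒳 : SchemeOver (WittVector p k)) {n : ℕ}
    {E₁ : (specialFibre 𝒳).left.Modules} (hE₁ : IsFiniteLocallyFree E₁)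
    {F : (thickening 𝒳 (n + 1)).left.Modules} (hF : IsFiniteLocallyFree F)
    (α : (Scheme.Modules.pullback (specialFibreToThickening 𝒳 n)).obj F ≅ E₁) :
    KZero.of E₁ hE₁ ∈ (KZero.map (specialFibreToThickening 𝒳 n)).range :=
  ⟨KZero.of F hF, by rw [KZero.map_of]; exact KZero.of_iso α _ _⟩

/-- A unit multiple vanishes iff the element does. -/
theorem units_smul_eq_zero_iff {M : Type*} [AddCommGroup M] (ε : ℤˣ) (x : M) :
    ε • x = 0 ↔ x = 0 := by
  constructor
  · intro h
    rw [← inv_smul_smul ε x, h, smul_zero]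
  · intro h
    rw [h, smul_zero]

/-! ## §6 One step from one character (the heart of the composition, the torsor test, the P1a bypass) -/

/-- **From the character of level `n` to (⋆) at level `n`**: for `{0,1}`-semiregular `E₁`, a finite
locally free lift `F` to `X_{n+1}` whose class is restricted from `K₀(X_{n+2})` extends to `X_{n+2}`.
Logic of Disproof §7 `liftsStep_of_padicBlochIdentity`: class lifts ⇒ `δ[E₁] = 0` (V) ⇒ `σ₀(o) =
σ₁(o) = 0` (I, the signs are units) ⇒ `o = 0` (semiregularity read on the obstruction group,
`isZeroOneSemiregular_iff_obstruction`) ⇒ `F` extends. -/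
theorem extends_of_classLifts (𝒳 : SchemeOver (WittVector p k)) {n : ℕ}
    (hD : HasStepCharacter 𝒳 n)
    {E₁ : (specialFibre 𝒳).left.Modules} (hE₁ : IsFiniteLocallyFree E₁) (hsr : IsZeroOneSemiregular hE₁)
    (F : (thickening 𝒳 (n + 1)).left.Modules) (hF : IsFiniteLocallyFree F)
    (α : (Scheme.Modules.pullback (specialFibreToThickening 𝒳 n)).obj F ≅ E₁)
    (hcls : ∃ y : KZero (thickening 𝒳 (n + 2)).left,
      KZero.map (thickeningMap 𝒳 (Nat.le_succ (n + 1))) y = KZero.of F hF) :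
    ExtendsToNextLevel 𝒳 n F := by
  obtain ⟨δ₀, δ₁, ε₀, ε₁, hvan, hid⟩ := hD
  have hx := kZero_of_mem_range 𝒳 hE₁ hF α
  obtain ⟨h0, h1⟩ := hvan ⟨KZero.of E₁ hE₁, hx⟩ (kZero_of_specialFibre_lifts 𝒳 hE₁ hF α hcls)
  obtain ⟨o, hob, hid0, hid1⟩ := hid E₁ hE₁ F hF ⟨α⟩ hx
  have hs0 : sigmaZeroObstruction hE₁ o = 0 := by
    rw [← units_smul_eq_zero_iff ε₀, ← hid0, h0]
  have hs1 : sigmaOneObstruction hE₁ o = 0 := by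
    rw [← units_smul_eq_zero_iff ε₁, ← hid1, h1]
  exact hob.1 ((isZeroOneSemiregular_iff_obstruction hE₁).1 hsr _ hs0 hs1)

/-- **TORSOR TEST, typed (Disproof §6)**: under a character of level `n`, for `{0,1}`-semiregular `E₁`
extendability across `X_{n+1} ⊂ X_{n+2}` is UNIFORM over all finite locally free lifts of `E₁` to
`X_{n+1}`: if one lift extends, every lift extends (`δ[E₁]` does not see the lift; `o` is determined by
`σ(o)`). This is the content a per-bundle datum could not separate from junk; it is false without
`H_tf` (Godeaux–Serre, Disproof §7 (i)) — a refuter kills the stubs by one semiregular `E₁` on a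
Hodge-torsion-free `𝒳` with two lifts to some `X_{n+1}`, one extending and one not. -/
theorem uniform_extension (𝒳 : SchemeOver (WittVector p k)) {n : ℕ}
    (hD : HasStepCharacter 𝒳 n)
    {E₁ : (specialFibre 𝒳).left.Modules} (hE₁ : IsFiniteLocallyFree E₁) (hsr : IsZeroOneSemiregular hE₁)
    (F : (thickening 𝒳 (n + 1)).left.Modules) (hF : IsFiniteLocallyFree F)
    (α : (Scheme.Modules.pullback (specialFibreToThickening 𝒳 n)).obj F ≅ E₁)
    (F' : (thickening 𝒳 (n + 1)).left.Modules) (hF' : IsFiniteLocallyFree F')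
    (α' : (Scheme.Modules.pullback (specialFibreToThickening 𝒳 n)).obj F' ≅ E₁)
    (hF_ext : ExtendsToNextLevel 𝒳 n F) : ExtendsToNextLevel 𝒳 n F' := by
  obtain ⟨δ₀, δ₁, ε₀, ε₁, -, hid⟩ := hD
  have hx := kZero_of_mem_range 𝒳 hE₁ hF α
  obtain ⟨o, hob, hid0, hid1⟩ := hid E₁ hE₁ F hF ⟨α⟩ hx
  obtain ⟨o', hob', hid0', hid1'⟩ := hid E₁ hE₁ F' hF' ⟨α'⟩ hx
  have ho : o = 0 := hob.2 hF_ext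
  have hs0 : sigmaZeroObstruction hE₁ o' = 0 := by
    rw [← units_smul_eq_zero_iff ε₀, ← hid0', hid0, ho, map_zero, smul_zero]
  have hs1 : sigmaOneObstruction hE₁ o' = 0 := by
    rw [← units_smul_eq_zero_iff ε₁, ← hid1', hid1, ho, map_zero, smul_zero]
  exact hob'.1 ((isZeroOneSemiregular_iff_obstruction hE₁).1 hsr _ hs0 hs1)

/-- **P1a BYPASS — step lifting from the vanishing of the character at `[E₁]`**: if
`δ₀[E₁] = δ₁[E₁] = 0` for a character of level `n` — for the INTENDED character this vanishing is the
Bloch–Esnault–Kerz Hodge condition read integrally (saturation of `F^r H_dR(𝒳/W)` in the torsion-free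
lattice under `H_tf`), a `C`-relative input the consumer supplies — then EVERY finite locally free lift of
a `{0,1}`-semiregular `E₁` to `X_{n+1}` extends to `X_{n+2}`, with no `K₀`-hypothesis: "semiregular +
Hodge + `H_tf` ⇒ every lift is unobstructed" (TRIAGE-r1-1/2/3, Disproof §7 RECOMMENDATION). -/
theorem extends_of_vanishing (𝒳 : SchemeOver (WittVector p k)) {n : ℕ}
    {δ₀ : (KZero.map (specialFibreToThickening 𝒳 n)).range →+
      structureSheafCohomology (specialFibre 𝒳).left 2}
    {δ₁ : (KZero.map (specialFibreToThickening 𝒳 n)).range →+ hodgeCohomologyOne (specialFibre 𝒳) 3}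
    {ε₀ ε₁ : ℤˣ} (hD : IsStepCharacter 𝒳 n δ₀ δ₁ ε₀ ε₁)
    {E₁ : (specialFibre 𝒳).left.Modules} (hE₁ : IsFiniteLocallyFree E₁) (hsr : IsZeroOneSemiregular hE₁)
    (hvan : ∀ hx : KZero.of E₁ hE₁ ∈ (KZero.map (specialFibreToThickening 𝒳 n)).range,
      δ₀ ⟨KZero.of E₁ hE₁, hx⟩ = 0 ∧ δ₁ ⟨KZero.of E₁ hE₁, hx⟩ = 0)
    (F : (thickening 𝒳 (n + 1)).left.Modules) (hF : IsFiniteLocallyFree F)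
    (α : (Scheme.Modules.pullback (specialFibreToThickening 𝒳 n)).obj F ≅ E₁) :
    ExtendsToNextLevel 𝒳 n F := by
  obtain ⟨-, hid⟩ := hD
  have hx := kZero_of_mem_range 𝒳 hE₁ hF α
  obtain ⟨h0, h1⟩ := hvan hx
  obtain ⟨o, hob, hid0, hid1⟩ := hid E₁ hE₁ F hF ⟨α⟩ hx
  have hs0 : sigmaZeroObstruction hE₁ o = 0 := by
    rw [← units_smul_eq_zero_iff ε₀, ← hid0, h0]
  have hs1 : sigmaOneObstruction hE₁ o = 0 := by
    rw [← units_smul_eq_zero_iff ε₁, ← hid1, h1]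
  exact hob.1 ((isZeroOneSemiregular_iff_obstruction hE₁).1 hsr _ hs0 hs1)

/-! ## §6b Tower assembly (the card's first lemma, `K₀`-free) -/

/-- Restriction bookkeeping along `X_k ⟶ X_{n+1} ⟶ X_{n+2}` (`pullbackCongr` + `pullbackComp`). -/
def pullbackSpecialFibreIso (𝒳 : SchemeOver (WittVector p k)) (n : ℕ)
    (E : (WittScheme.thickening 𝒳 (n + 2)).left.Modules) :
    (Scheme.Modules.pullback (specialFibreToThickening 𝒳 (n + 1))).obj E ≅
      (Scheme.Modules.pullback (specialFibreToThickening 𝒳 n)).obj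
        ((Scheme.Modules.pullback (thickeningMap 𝒳 (Nat.le_succ (n + 1)))).obj E) :=
  (Scheme.Modules.pullbackCongr (specialFibreToThickening_comp_thickeningMap 𝒳 n).symm).app E ≪≫
    ((Scheme.Modules.pullbackComp (specialFibreToThickening 𝒳 n)
      (thickeningMap 𝒳 (Nat.le_succ (n + 1)))).app E).symm

/-- **TOWER ASSEMBLY**: a finite locally free lift of `E₁` to `X₁` plus STEP LIFTING at every level
(every finite locally free lift of `E₁` to `X_{n+1}` extends to `X_{n+2}`) give `LiftsFormally 𝒳 E₁` —
induction and choice along the tower, no obstruction theory and no `K₀`. -/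
theorem liftsFormally_of_stepLifting (𝒳 : SchemeOver (WittVector p k))
    (E₁ : (specialFibre 𝒳).left.Modules)
    (h₀ : ∃ F : (WittScheme.thickening 𝒳 1).left.Modules, IsFiniteLocallyFree F ∧
      Nonempty ((Scheme.Modules.pullback (specialFibreToThickening 𝒳 0)).obj F ≅ E₁))
    (hstep : ∀ (n : ℕ) (F : (WittScheme.thickening 𝒳 (n + 1)).left.Modules), IsFiniteLocallyFree F →
      ((Scheme.Modules.pullback (specialFibreToThickening 𝒳 n)).obj F ≅ E₁) →
      ExtendsToNextLevel 𝒳 n F) :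
    LiftsFormally 𝒳 E₁ := by
  classical
  let Stage : ℕ → Type 1 := fun n =>
    { F : (WittScheme.thickening 𝒳 (n + 1)).left.Modules // IsFiniteLocallyFree F ∧
        Nonempty ((Scheme.Modules.pullback (specialFibreToThickening 𝒳 n)).obj F ≅ E₁) }
  let base : Stage 0 :=
    ⟨Classical.choose h₀, (Classical.choose_spec h₀).1, (Classical.choose_spec h₀).2⟩
  have step : ∀ (n : ℕ) (s : Stage n), { s' : Stage (n + 1) //
      Nonempty ((Scheme.Modules.pullback (thickeningMap 𝒳 (Nat.le_succ (n + 1)))).obj s'.1 ≅ s.1) } := by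
    intro n s
    have hl := hstep n s.1 s.2.1 s.2.2.some
    let F' : (WittScheme.thickening 𝒳 (n + 2)).left.Modules := Classical.choose hl
    have hF' := Classical.choose_spec hl
    let t := hF'.2.some
    exact ⟨⟨F', hF'.1, ⟨pullbackSpecialFibreIso 𝒳 n F' ≪≫
      (Scheme.Modules.pullback (specialFibreToThickening 𝒳 n)).mapIso t ≪≫ s.2.2.some⟩⟩, ⟨t⟩⟩
  let stages : ∀ n, Stage n := fun n => Nat.rec base (fun n s => (step n s).1) n
  refine ⟨fun n => (stages n).1, fun n => (stages n).2.1.isVectorBundle, fun n => ?_, (stages 0).2.2⟩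
  exact (step n (stages n)).2

/-- **The card's repaired P1 at object level** (`CrystallineAbelJacobiFirstLemma` of the idea card, with
the characters in place of the posited package): a `{0,1}`-semiregular `E₁` that lifts to `X₁` and at
whose class the character of every level VANISHES lifts FORMALLY — `LiftsFormally 𝒳 E₁` without
`FormalLiftingFromClassLifting`, without `K₀` of the thickenings and without `p > d + 6`. -/
theorem liftsFormally_of_hodgeCharacters (𝒳 : SchemeOver (WittVector p k))
    {E₁ : (specialFibre 𝒳).left.Modules} (hE₁ : IsFiniteLocallyFree E₁)
    (hsr : IsZeroOneSemiregular hE₁)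
    (h₀ : ∃ F : (WittScheme.thickening 𝒳 1).left.Modules, IsFiniteLocallyFree F ∧
      Nonempty ((Scheme.Modules.pullback (specialFibreToThickening 𝒳 0)).obj F ≅ E₁))
    (hD : ∀ n : ℕ, ∃ (δ₀ : (KZero.map (specialFibreToThickening 𝒳 n)).range →+
          structureSheafCohomology (specialFibre 𝒳).left 2)
        (δ₁ : (KZero.map (specialFibreToThickening 𝒳 n)).range →+ hodgeCohomologyOne (specialFibre 𝒳) 3)
        (ε₀ ε₁ : ℤˣ), IsStepCharacter 𝒳 n δ₀ δ₁ ε₀ ε₁ ∧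
          ∀ hx : KZero.of E₁ hE₁ ∈ (KZero.map (specialFibreToThickening 𝒳 n)).range,
            δ₀ ⟨KZero.of E₁ hE₁, hx⟩ = 0 ∧ δ₁ ⟨KZero.of E₁ hE₁, hx⟩ = 0) :
    LiftsFormally 𝒳 E₁ :=
  liftsFormally_of_stepLifting 𝒳 E₁ h₀ fun n F hF α => by
    obtain ⟨δ₀, δ₁, ε₀, ε₁, hC, hvan⟩ := hD n
    exact extends_of_vanishing 𝒳 hC hE₁ hsr hvan F hF α

end Witt

/-! ## §7 The composition: the two stubs imply the crux reading, by name -/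

/-- **`PadicPridhamSemiregularity` from the two stubs** (pure logic over §5–§6, no `sorry`): at level
`n = 0` use the first-step character, at level `n ≥ 1` the deep-step character; `d + 6 < p` gives
`p ≠ 2` and `d < p`. -/
theorem PadicPridhamSemiregularity_of (h₁ : Forms.stub_firstStepCharacter)
    (h₂ : Forms.stub_deepStepsCharacter) : PadicPridhamSemiregularity := by
  intro p _ k _ _ _ d 𝒳 h𝒳 hproj hp htf E₁ hE₁ hsr n F hF hα hcls
  obtain ⟨α⟩ := hα
  have hp2 : p ≠ 2 := by omega
  have hdp : d < p := by omega
  have hD : HasStepCharacter 𝒳 n := by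
    rcases n with _ | m
    · exact h₁ p k d 𝒳 h𝒳 hproj hp2 hdp htf
    · exact h₂ p k d 𝒳 h𝒳 hproj hp2 hdp htf (m + 1) (Nat.succ_pos m)
  exact extends_of_classLifts 𝒳 hD hE₁ hsr F hF α hcls

/-- Wiring check: the registered stubs feed `PadicPridhamSemiregularity_of` as stated. -/
example : PadicPridhamSemiregularity :=
  PadicPridhamSemiregularity_of stub_firstStepCharacter stub_deepStepsCharacter

/-! ## §8 The landed Negative lemmas of this crux, at the stubs' hypotheses -/

/-- **Window collapse inside `stub_deepStepsCharacter`**: at its hypotheses `p` prime, `p ≠ 2`, `1 ≤ n`,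
every divided-power / Taylor term of order `j ≥ 2` in the difference `p^{n+1}θ`… — here in the
normalisation of `Negative.dividedPowerWindowCollapse` (`n ≥ 1`, `j ≥ 2`: `n + 1 + v_p(j!) ≤ nj`) — dies
modulo the next power of `p`; this is the arithmetic that puts `π_{n+2}(ch_r^cris)` in the LAST COLUMN
(transversality), i.e. that makes `δ_{r-1}` well defined with values in `H^{r+1}(X_k, Ω^{r-1})`. -/
theorem windowCollapse_at_deepSteps {p : ℕ} [hp : Fact p.Prime] (hp2 : p ≠ 2) {n : ℕ} (hn : 1 ≤ n)
    (j : ℕ) (hj : 2 ≤ j) : n + 1 + padicValNat p j.factorial ≤ n * j :=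
  Summit.HodgeConjecture.HodgeConjecture.Theorems.PadicPridhamSemiregularity.Negative.dividedPowerWindowCollapse
    p hp.out hp2 n j hn hj

/-- … and the stubs rightly exclude `p = 2`, where the window does NOT collapse. -/
example : ¬ ((1 : ℕ) + 1 + padicValNat 2 (Nat.factorial 2) ≤ 1 * 2) :=
  Summit.HodgeConjecture.HodgeConjecture.Theorems.PadicPridhamSemiregularity.Negative.dividedPowerWindow_fails_at_two

/-- **Torsor test, σ-side (landed)**: over the tree's interface `AtiyahTraceAlgebra` with graded-central
Atiyah class and cyclic trace, `σ(x ∘ x) = 0` when `2` is invertible — the quadratic term of the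
lift-change formula `o(F + e) = o(F) + β(e) + [n = 2](e ∘ e)` dies under `σ`, so the lift-dependence of
`σ(o(F))` is a Bockstein image, killed by `H_tf`: exactly the uniformity `uniform_extension` derives from
the character. -/
example {𝕜 : Type} [CommRing 𝕜] [Invertible (2 : 𝕜)] (A : AtiyahTraceAlgebra.{0, 0} 𝕜)
    (hC : ∀ (i a : ℕ) (ha : 1 + i = a) (ha' : i + 1 = a) (x : A.Ext i 0),
      A.mul ha (show 1 + 0 = 1 from rfl) A.atiyah x =
        ((-1 : 𝕜) ^ i) • A.mul ha' (show 0 + 1 = 1 from rfl) x A.atiyah)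
    (hT : ∀ (i j i' j' a b : ℕ) (ha : i + i' = a) (hb : j + j' = b) (ha' : i' + i = a)
      (hb' : j' + j = b) (y : A.Ext i j) (z : A.Ext i' j'),
      A.trace a b (A.mul ha hb y z) =
        ((-1 : 𝕜) ^ (i * i' + j * j')) • A.trace a b (A.mul ha' hb' z y))
    (x : A.Ext 1 0) :
    A.semiregularityMap (A.mul (rfl : 1 + 1 = 2) (rfl : 0 + 0 = 0) x x) = 0 :=
  Summit.HodgeConjecture.HodgeConjecture.Theorems.PadicPridhamSemiregularity.Negative.semiregularityMap_sq_eq_zero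
    hC hT x

end Summit.HodgeConjecture.HodgeConjecture.Cruxes.PadicPridhamSemiregularity.CrystallineAbelJacobi

end
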